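import Summits.BirchSwinnertonDyer.BirchSwinnertonDyer.Theorems.Rank1ResidualPartitionEmptyCellsCM
import Summits.BirchSwinnertonDyer.Rank1Residual.X9.BigImageWitnesses
import Literature.NumberTheory.EllipticCurves.BSDSelmerCMPConverseKLevelProofs
import HarnessLib

set_option linter.dupNamespace false
set_option autoImplicit false

/-!
# Partition lemma — hyp part 6 / tree part 8: the IMAGE kernel-empty cells
(`Summits/BirchSwinnertonDyer/BirchSwinnertonDyer/Theorems/Rank1ResidualPartitionEmptyCellsImage.lean`)

HONEST FRAMING (cell `b2b-bsdres`, run/shared/lean/b2b/bsd-rank1-residual/, verbatim in every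
file): the goal of the cell is to DELETE the COMBINATION-SHAPED residual classes of the
Birch–Swinnerton-Dyer formula for ALL analytic-rank `≤ 1` elliptic curves over `ℚ` — "full BSD
formula for every rank `≤ 1` curve in class `C`" assembled STRICTLY from published theorems — so
that the rank-`≤ 1` remainder becomes exactly the CONSTRUCTION-SHAPED classes, which are TYPED
(missing-input `Prop`s), NOT attempted. This is not "finishing BSD". Prove what is provable now;
shrink each hard class to its core with data; no claim beyond stated classes.

Theorems only; APPEND to part 7 (`…EmptyCellsCM.lean`, p206629): nothing there, in parts 1–6 or in
the table `Cell.classify` is edited. The x9 seats landed four class-free PROVED warrants about the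
image atoms `im ∈ {surj, smallIrr, red}` / `bigIm` ((Im) of BCS) that the grid does not yet know:

* E8 `smallIrr ∧ ram` — empty by `surj_of_irr_of_ram` (X9NoEntry.lean: at an irreducible prime a
  ramified multiplicative prime forces surjectivity; Serre 1972 Prop. 15; every `p`);
* E9 `surj ∧ ram ∧ ¬bigIm` — empty by `X9.bigIm_of_surj_of_ram` (BigImageWitnesses.lean; every `p`);
* E10 `surj ∧ p ≥ 5 ∧ ¬bigIm` — empty by `X9.bigIm_of_surj` (SurjBigImage.lean; Serre 1968 IV-23:
  the census convention §a.0 "(im) ⇐ surj(p), p ≥ 5" is a tree theorem);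
* E11 `cm ∧ p ≥ 5 ∧ goodOrd ∧ surj` — empty by
  `not_hasSurjectiveModNGaloisRep_of_hasCM_of_not_dvd_frobeniusTrace` (Serre 1972 §4.5: the image
  normalises a Cartan subgroup, so contains no transvection).

`Cell.kernelEmpty₃ := kernelEmpty₂ ∨ E8 ∨ E9 ∨ E10 ∨ E11`, `Cell.consistent₄ := consistent ∧
¬kernelEmpty₃`; `cellOf_consistent₄` for every real pair. Kernel statements (`decide +kernel` over
all 36 864 cells): (S7) on `consistent₄` cells with `p ≥ 5 ∧ irr`, `bigIm = surj` (the grid form of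
`X9.bigIm_iff_surj_of_irr`); (S8) **no `consistent₄` cell is classified X9im** — finding F2 of the
partition lemma (the `(surj, ¬(im))` slot of RESIDUAL-CASES §a.2) is closed at TABLE level: for every
real pair `classify (cellOf E p) ≠ X9im`; (S9) a `consistent₄` C1 cell (Skinner 2016 Thm. C, (irr) +
(ram)) is `surj ∧ bigIm` — the remark of BigImageWitnesses.lean as a table theorem; (S10) on
`consistent₄` cells the X9 verdict is exactly `¬cm ∧ goodOrd ∧ p ≥ 5 ∧ smallIrr ∧ ¬ram ∧ ¬sst ∧
¬bigIm` (rank free). Kernel counts: `consistent₄` 6 160 (1 696 of the 7 856 `consistent₃` cells are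
E8–E11-empty); X9im 64 → 0; X9 48 → 32. Per-verdict table by two engines (B Python
`emptycells_im_enum.py` / A′ Lean `#eval`) in HOME/PARTITION.md §9: C1 320 → 128, C10 96 → 48,
C16 144 → 112, C17 144 → 76, C3 224 → 136, C8 320 → 184, X11a 160 → 128, X11b 320 → 192, X12 80 → 60,
X4 384 → 224, X5 3 120 → 2 624, X6 96 → 56, X7 288 → 160, X8 160 → 112, X9 48 → 32, X9im 64 → 0;
unchanged C2 64, C6 512, C7 128, X1 384, X10 32, X2 512, X3 256. Data side (D11.1 placement census,
428 378 examined pairs of the window N < 2·10⁴): 0 pairs in any of E8–E11 (1 880 smallIrr pairs, none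
ramified). Nothing is booked; labels unchanged; no named fact is introduced; axioms standard.
hyp seat GEN 11.
-/

/-! Cell-level declarations: dot-notation extensions of `Summit.BirchSwinnertonDyer.Rank1Residual.Cell`
(Partition/Grid.lean), declared with absolute names (lean/CONVENTIONS.md §2). -/

namespace Summit.BirchSwinnertonDyer.Rank1Residual.Cell

variable (c : Cell)

/-! ## §1 The four image families -/

/-- E8: `irr(p) ∧ ¬surj(p) ∧ ram(p)` (x9 `surj_of_irr_of_ram`: irreducible + a ramified multiplicative
prime ⇒ surjective, every `p`). [folklore] -/
def emptySmallIrrRam : Bool := c.smallIrr && c.ram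
/-- E9: `surj(p) ∧ ram(p) ∧ ¬(im)` (`X9.bigIm_of_surj_of_ram`, every `p`). [folklore] -/
def emptySurjRamNotBig : Bool := c.surj && c.ram && !c.bigIm
/-- E10: `surj(p) ∧ p ≥ 5 ∧ ¬(im)` (`X9.bigIm_of_surj`, Serre IV-23). [folklore] -/
def emptySurjGe5NotBig : Bool := c.surj && c.ge5 && !c.bigIm
/-- E11: `cm ∧ p ≥ 5 ∧ ord(p) ∧ surj(p)` (Serre 1972 §4.5: a CM curve is not surjective at a good
ordinary `p > 3`). [folklore] -/
def emptyCMGe5OrdSurj : Bool := c.cm && c.ge5 && c.goodOrd && c.surj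

/-- The cell lies in one of the eleven kernel-empty families E1–E11. [folklore] -/
def kernelEmpty₃ : Bool :=
  c.kernelEmpty₂ || c.emptySmallIrrRam || c.emptySurjRamNotBig || c.emptySurjGe5NotBig ||
    c.emptyCMGe5OrdSurj

/-- Refined consistency, fourth level: part 1's four constraints and none of E1–E11. [folklore] -/
def consistent₄ : Bool := c.consistent && !c.kernelEmpty₃

/-- `consistent₄` refines `consistent₃`. [folklore] -/
theorem consistent₃_of_consistent₄ (h : c.consistent₄ = true) : c.consistent₃ = true := by
  simp only [consistent₄, consistent₃, kernelEmpty₃, Bool.and_eq_true, Bool.not_eq_true',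
    Bool.or_eq_false_iff] at h ⊢
  exact ⟨h.1, h.2.1.1.1.1⟩

/-- The X9 core shape, fourth level: non-CM, good ordinary, `p ≥ 5`, irreducible non-surjective,
no ramified multiplicative prime, not semistable, not (im) — rank free. [folklore] -/
def x9Core₄ : Bool :=
  !c.cm && c.goodOrd && c.ge5 && c.smallIrr && !c.ram && !c.sst && !c.bigIm

/-- The table's verdict is X9, as a Boolean. [folklore] -/
def isX9 : Bool := decide (c.classify = .residual .X9)
/-- The table's verdict is X9im, as a Boolean. [folklore] -/
def isX9im : Bool := decide (c.classify = .residual .X9im)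

/-- Specification S7: on `consistent₄` cells with `p ≥ 5 ∧ irr`, `bigIm = surj`. [folklore] -/
def irrGe5ImageSpec : Bool := !(c.consistent₄ && c.ge5 && c.irr) || (c.bigIm == c.surj)

/-- Specification S8: no `consistent₄` cell is classified X9im. [folklore] -/
def x9imEmptySpec : Bool := !(c.consistent₄ && c.isX9im)

/-- Specification S9: a `consistent₄` C1 cell is surjective with big image. [folklore] -/
def c1ImageSpec : Bool := !(c.consistent₄ && c.hasVerdict (.covered .C1)) || (c.surj && c.bigIm)

/-- Specification S10: on `consistent₄` cells, verdict X9 ⟺ `x9Core₄`. [folklore] -/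
def x9Core₄Spec : Bool := (c.consistent₄ && c.isX9) == (c.consistent₄ && c.x9Core₄)

/-! ## §2 The finite verification -/

/-- Raw form of S7. [folklore] -/
theorem irrGe5Image_spec_raw :
    ∀ (pk : PK) (red : RedK) (im : ImK) (bigIm : Bool) (rk : RK)
      (cm ram sst anom gvpar a3zero cmSplit cmRam : Bool),
      (Cell.mk pk red im bigIm rk cm ram sst anom gvpar a3zero cmSplit cmRam).irrGe5ImageSpec = true := by
  decide +kernel

/-- Cell form of S7. [folklore] -/
theorem irrGe5Image_spec (c : Cell) : c.irrGe5ImageSpec = true := by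
  obtain ⟨pk, red, im, bigIm, rk, cm, ram, sst, anom, gvpar, a3zero, cmSplit, cmRam⟩ := c
  exact irrGe5Image_spec_raw pk red im bigIm rk cm ram sst anom gvpar a3zero cmSplit cmRam

/-- **S7.** On fourth-level-consistent irreducible cells with `p ≥ 5`, the atoms (im) and surj
coincide. [folklore] -/
theorem bigIm_eq_surj_of_ge5_irr (c : Cell) (hc : c.consistent₄ = true) (h5 : c.ge5 = true)
    (hi : c.irr = true) : c.bigIm = c.surj := by
  have h := irrGe5Image_spec c
  simpa [irrGe5ImageSpec, hc, h5, hi] using h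

/-- Raw form of S8. [folklore] -/
theorem x9imEmpty_spec_raw :
    ∀ (pk : PK) (red : RedK) (im : ImK) (bigIm : Bool) (rk : RK)
      (cm ram sst anom gvpar a3zero cmSplit cmRam : Bool),
      (Cell.mk pk red im bigIm rk cm ram sst anom gvpar a3zero cmSplit cmRam).x9imEmptySpec = true := by
  decide +kernel

/-- Cell form of S8. [folklore] -/
theorem x9imEmpty_spec (c : Cell) : c.x9imEmptySpec = true := by
  obtain ⟨pk, red, im, bigIm, rk, cm, ram, sst, anom, gvpar, a3zero, cmSplit, cmRam⟩ := c
  exact x9imEmpty_spec_raw pk red im bigIm rk cm ram sst anom gvpar a3zero cmSplit cmRam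

/-- **S8.** No fourth-level-consistent cell is classified X9im. [folklore] -/
theorem classify_ne_X9im (c : Cell) (hc : c.consistent₄ = true) : c.classify ≠ .residual .X9im := by
  intro hv
  have h := x9imEmpty_spec c
  have hx : c.isX9im = true := by simpa [isX9im] using hv
  simp [x9imEmptySpec, hc, hx] at h

/-- Raw form of S9. [folklore] -/
theorem c1Image_spec_raw :
    ∀ (pk : PK) (red : RedK) (im : ImK) (bigIm : Bool) (rk : RK)
      (cm ram sst anom gvpar a3zero cmSplit cmRam : Bool),
      (Cell.mk pk red im bigIm rk cm ram sst anom gvpar a3zero cmSplit cmRam).c1ImageSpec = true := by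
  decide +kernel

/-- Cell form of S9. [folklore] -/
theorem c1Image_spec (c : Cell) : c.c1ImageSpec = true := by
  obtain ⟨pk, red, im, bigIm, rk, cm, ram, sst, anom, gvpar, a3zero, cmSplit, cmRam⟩ := c
  exact c1Image_spec_raw pk red im bigIm rk cm ram sst anom gvpar a3zero cmSplit cmRam

/-- **S9.** A fourth-level-consistent cell classified C1 is surjective with big image. [folklore] -/
theorem surj_bigIm_of_C1 (c : Cell) (hc : c.consistent₄ = true)
    (hv : c.hasVerdict (.covered .C1) = true) : c.surj = true ∧ c.bigIm = true := by
  have h := c1Image_spec c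
  simpa [c1ImageSpec, hc, hv] using h

/-- Raw form of S10. [folklore] -/
theorem x9Core₄_spec_raw :
    ∀ (pk : PK) (red : RedK) (im : ImK) (bigIm : Bool) (rk : RK)
      (cm ram sst anom gvpar a3zero cmSplit cmRam : Bool),
      (Cell.mk pk red im bigIm rk cm ram sst anom gvpar a3zero cmSplit cmRam).x9Core₄Spec = true := by
  decide +kernel

/-- **S10.** On the fourth-level grid the X9 verdict is exactly the X9 core shape. [folklore] -/
theorem x9Core₄_spec (c : Cell) : (c.consistent₄ && c.isX9) = (c.consistent₄ && c.x9Core₄) := by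
  obtain ⟨pk, red, im, bigIm, rk, cm, ram, sst, anom, gvpar, a3zero, cmSplit, cmRam⟩ := c
  have h := x9Core₄_spec_raw pk red im bigIm rk cm ram sst anom gvpar a3zero cmSplit cmRam
  simpa only [x9Core₄Spec, beq_iff_eq] using h

/-- S10, implication form. [folklore] -/
theorem x9Core₄_of_classify (c : Cell) (hc : c.consistent₄ = true)
    (h : c.classify = .residual .X9) : c.x9Core₄ = true := by
  have hs := x9Core₄_spec c
  have hx : c.isX9 = true := by simpa [isX9] using h
  simpa [hc, hx] using hs.symm

/-! ## §2b Kernel counts (headline numbers; the per-verdict table is certified outside the tree by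
engines B / A′, HOME/b2b-bsdres-hyp/hyp/partition3/) -/

/-- **6 160 cells are fourth-level consistent; 1 696 `consistent₃` cells are E8–E11-empty.**
[folklore] -/
theorem count_consistent₄ :
    count (·.consistent₄) = 6160 ∧
    count (fun c => c.consistent₃ && (c.emptySmallIrrRam || c.emptySurjRamNotBig ||
      c.emptySurjGe5NotBig || c.emptyCMGe5OrdSurj)) = 1696 := by
  constructor <;> decide +kernel

/-- **X9im: 0 fourth-level-consistent cells (64 at level 3); X9: 32 (48 at level 3).** [folklore] -/
theorem count_X9₄ :
    count (fun c => c.consistent₄ && c.isX9im) = 0 ∧ count (fun c => c.consistent₄ && c.isX9) = 32 := by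
  constructor <;> decide +kernel

end Summit.BirchSwinnertonDyer.Rank1Residual.Cell

/-! ## §3 Real pairs -/

namespace Summit.BirchSwinnertonDyer.BirchSwinnertonDyer.Rank1Residual.Partition

open WeierstrassCurve Literature.NumberTheory.EllipticCurves
  Literature.NumberTheory.EllipticCurves.Rank1Residual Summit.BirchSwinnertonDyer.Rank1Residual

section Curve

open scoped Classical

variable (W : WeierstrassCurve ℚ) [W.IsElliptic] [W.IsGloballyMinimal] (p : ℕ) [Fact p.Prime]

/-- E8 on real pairs: `irr ∧ ram ⇒ surj` (x9 `surj_of_irr_of_ram`). [folklore] -/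
theorem cellOf_emptySmallIrrRam : (cellOf W p).emptySmallIrrRam = false := by
  rw [Bool.eq_false_iff, ne_eq]
  intro h
  simp only [Cell.emptySmallIrrRam, Bool.and_eq_true] at h
  obtain ⟨hsi, hram⟩ := h
  obtain ⟨hirr, hns⟩ := (cellOf_smallIrr W p).1 hsi
  exact hns (surj_of_irr_of_ram W p hirr ((cellOf_ram W p).1 hram))

/-- E9 on real pairs: `surj ∧ ram ⇒ (im)` (`X9.bigIm_of_surj_of_ram`). [folklore] -/
theorem cellOf_emptySurjRamNotBig : (cellOf W p).emptySurjRamNotBig = false := by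
  rw [Bool.eq_false_iff, ne_eq]
  intro h
  simp only [Cell.emptySurjRamNotBig, Bool.and_eq_true, Bool.not_eq_true'] at h
  obtain ⟨⟨hs, hr⟩, hb⟩ := h
  exact (cellOf_bigIm_false W p).1 hb
    (X9.bigIm_of_surj_of_ram W p ((cellOf_surj W p).1 hs) ((cellOf_ram W p).1 hr))

/-- E10 on real pairs: `surj ∧ p ≥ 5 ⇒ (im)` (`X9.bigIm_of_surj`, Serre IV-23). [folklore] -/
theorem cellOf_emptySurjGe5NotBig : (cellOf W p).emptySurjGe5NotBig = false := by
  rw [Bool.eq_false_iff, ne_eq]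
  intro h
  simp only [Cell.emptySurjGe5NotBig, Bool.and_eq_true, Bool.not_eq_true'] at h
  obtain ⟨⟨hs, h5⟩, hb⟩ := h
  exact (cellOf_bigIm_false W p).1 hb
    (X9.bigIm_of_surj W p ((cellOf_ge5 W p).1 h5) ((cellOf_surj W p).1 hs))

/-- E11 on real pairs: `cm ∧ p ≥ 5 ∧ ord ⇒ ¬surj` (Serre 1972 §4.5,
`not_hasSurjectiveModNGaloisRep_of_hasCM_of_not_dvd_frobeniusTrace`). [folklore] -/
theorem cellOf_emptyCMGe5OrdSurj : (cellOf W p).emptyCMGe5OrdSurj = false := by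
  rw [Bool.eq_false_iff, ne_eq]
  intro h
  simp only [Cell.emptyCMGe5OrdSurj, Bool.and_eq_true] at h
  obtain ⟨⟨⟨hcm, h5⟩, ho⟩, hs⟩ := h
  have hgo : W.HasGoodReductionAtPrime p ∧ ¬ (p : ℤ) ∣ W.frobeniusTrace p := (cellOf_goodOrd W p).1 ho
  have h5' : 5 ≤ p := (cellOf_ge5 W p).1 h5
  exact not_hasSurjectiveModNGaloisRep_of_hasCM_of_not_dvd_frobeniusTrace W ((cellOf_cm W p).1 hcm) p
    (by omega) hgo.1 hgo.2 ((cellOf_surj W p).1 hs)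

/-- **The cell of a real pair is in none of E1–E11.** [folklore] -/
theorem cellOf_kernelEmpty₃ : (cellOf W p).kernelEmpty₃ = false := by
  simp [Cell.kernelEmpty₃, cellOf_kernelEmpty₂, cellOf_emptySmallIrrRam, cellOf_emptySurjRamNotBig,
    cellOf_emptySurjGe5NotBig, cellOf_emptyCMGe5OrdSurj]

/-- **The cell of a real pair is fourth-level consistent.** [folklore] -/
theorem cellOf_consistent₄ : (cellOf W p).consistent₄ = true := by
  simp [Cell.consistent₄, cellOf_consistent, cellOf_kernelEmpty₃]

/-- **Class X9im is empty: the table never sends a real pair to X9im** (S8 transported to curves;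
finding F2 of the partition lemma closed at table level). [folklore] -/
theorem classify_cellOf_ne_X9im : Cell.classify (cellOf W p) ≠ .residual .X9im :=
  Cell.classify_ne_X9im _ (cellOf_consistent₄ W p)

/-- **Every pair the table sends to C1 is surjective at `p` with big `p`-adic image** (S9
transported to curves). [folklore] -/
theorem surj_bigIm_of_classify_cellOf_eq_C1 (h : Cell.classify (cellOf W p) = .covered .C1) :
    Surj W p ∧ BigIm W p := by
  have hv : (cellOf W p).hasVerdict (.covered .C1) = true := by simpa [Cell.hasVerdict] using h
  obtain ⟨hs, hb⟩ := Cell.surj_bigIm_of_C1 _ (cellOf_consistent₄ W p) hv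
  exact ⟨(cellOf_surj W p).1 hs, (cellOf_bigIm W p).1 hb⟩

/-- **Every pair the table sends to X9 is non-CM, good ordinary at `p ≥ 5`, irreducible and
non-surjective at `p`, with no ramified multiplicative prime, not semistable, and without big
image** (S10 transported to curves). [folklore] -/
theorem classify_cellOf_eq_X9_imp₄ (h : Cell.classify (cellOf W p) = .residual .X9) :
    ¬ W.HasCM ∧ GoodOrd W p ∧ 5 ≤ p ∧ Irr W p ∧ ¬ Surj W p ∧ ¬ Ram W p ∧ ¬ Semistable W ∧
      ¬ BigIm W p := by
  have hx := Cell.x9Core₄_of_classify _ (cellOf_consistent₄ W p) h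
  simp only [Cell.x9Core₄, Bool.and_eq_true, Bool.not_eq_true'] at hx
  obtain ⟨⟨⟨⟨⟨⟨hcm, ho⟩, h5⟩, hsi⟩, hram⟩, hsst⟩, hbig⟩ := hx
  obtain ⟨hirr, hns⟩ := (cellOf_smallIrr W p).1 hsi
  exact ⟨(cellOf_cm_false W p).1 hcm, (cellOf_goodOrd W p).1 ho, (cellOf_ge5 W p).1 h5, hirr, hns,
    (cellOf_ram_false W p).1 hram, (cellOf_sst_false W p).1 hsst, (cellOf_bigIm_false W p).1 hbig⟩

end Curve

end Summit.BirchSwinnertonDyer.BirchSwinnertonDyer.Rank1Residual.Partition
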